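import Summits.CriticalPhenomena.PercolationContinuityZ3.Theorems.PercNearOneGluingNoHeavyLowerTailCILCutObserverSteinerTools
import HarnessLib

/-!
# `NoHeavyLowerTail` (stmt-CriticalPhenomena-4575) — tools for gluing instances at the observer (blocks)

Support file (prover `prim-hp-5`, technique "blob-quotient induction"; `--supports
stmt-CriticalPhenomena-4575`).  No definitions, no named facts, no sorries.  Bookkeeping for
`CutObserver.SteinerPorts.Blocks.tform_blocks` (file `…CILObserverBlocks`): an observer `o` inside a vertex set
`W` whose complement `W ∖ o` is covered by pairwise disjoint, pairwise non-adjacent BLOCKS `V l`, the observer's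
own pairs into the blocks being arbitrary (several pairs into one block allowed).  Each block instance is read
inside `insert o (V l)`; the loop `s(o,o)` is the only pair two such sets share, and it is invisible to the open
graph (`openGraph_inter_erase_loop`), so the block events are determined by the pairwise disjoint loop-free
pair sets (`determinedBy_inter`, `blockSupports_disjoint`).  Geometry on the support event: the observer's
cluster inside `W` is the union of its block clusters (`Blocks.reach_observer_iff`); a block vertex not joined to
the observer inside its block keeps its block cluster (`Blocks.reach_block_iff`).
-/

noncomputable section

namespace Summit.CriticalPhenomena.PercolationContinuityZ3.Theorems

open MeasureTheory Set Literature.Probability.LatticeModels Literature.Probability.Percolation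
open scoped Classical BigOperators

variable {n : ℕ}

namespace CutObserver

namespace SteinerPorts

/-! ### Blocks at the observer: the T-form is closed under gluing instances at the observer -/

namespace Blocks

/-- Erasing the loop `s(o,o)` from the pairs read does not change the open graph. [folklore] -/
theorem openGraph_inter_erase_loop (ω : BondConfig (Fin n)) (X : Finset (Fin n)) (o : Fin n) :
    openGraph (ω ∩ ↑(X.sym2.erase s(o, o))) = openGraph (ω ∩ ↑(X.sym2)) := by
  ext u v
  rw [openGraph, openGraph, SimpleGraph.fromEdgeSet_adj, SimpleGraph.fromEdgeSet_adj]
  simp only [mem_inter_iff, Finset.mem_coe, Finset.mem_erase]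
  constructor
  · rintro ⟨⟨hω, -, hX⟩, hne⟩; exact ⟨⟨hω, hX⟩, hne⟩
  · rintro ⟨⟨hω, hX⟩, hne⟩
    refine ⟨⟨hω, ?_, hX⟩, hne⟩
    intro h
    rw [Sym2.eq_iff] at h
    rcases h with ⟨rfl, rfl⟩ | ⟨rfl, rfl⟩ <;> exact hne rfl

/-- An event read off `ω ∩ F` is determined by `F`. [folklore] -/
theorem determinedBy_inter (F : Finset (Sym2 (Fin n))) (Φ : BondConfig (Fin n) → Prop) :
    DeterminedBy {ω : BondConfig (Fin n) | Φ (ω ∩ ↑F)} (↑F : Set (Sym2 (Fin n))) := by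
  rw [determinedBy_iff]
  intro ω ω' h
  simp only [mem_setOf_eq]
  rw [h]

/-- The loop-free pair sets of two blocks sharing only the observer are disjoint. [folklore] -/
theorem blockSupports_disjoint (o : Fin n) {d : ℕ} (V : Fin d → Finset (Fin n))
    (hdisj : ∀ l l', l ≠ l' → Disjoint (V l) (V l')) {k k' : Fin d} (hkk' : k ≠ k') :
    Disjoint ((insert o (V k)).sym2.erase s(o, o)) ((insert o (V k')).sym2.erase s(o, o)) := by
  rw [Finset.disjoint_left]
  intro e he he'
  rw [Finset.mem_erase, Finset.mem_sym2_iff] at he he'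
  induction e using Sym2.ind with
  | h x y =>
    have hx := he.2 x (Sym2.mem_mk_left x y)
    have hy := he.2 y (Sym2.mem_mk_right x y)
    have hx' := he'.2 x (Sym2.mem_mk_left x y)
    have hy' := he'.2 y (Sym2.mem_mk_right x y)
    rw [Finset.mem_insert] at hx hy hx' hy'
    have hxo : x = o := by
      rcases hx with h | h
      · exact h
      · rcases hx' with h' | h'
        · exact h'
        · exact absurd h' (Finset.disjoint_left.1 (hdisj k k' hkk') h)
    have hyo : y = o := by
      rcases hy with h | h
      · exact h
      · rcases hy' with h' | h'
        · exact h'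
        · exact absurd h' (Finset.disjoint_left.1 (hdisj k k' hkk') h)
    exact he.1 (by rw [hxo, hyo])

section Geometry

variable (w : Sym2 (Fin n) → unitInterval) (W : Finset (Fin n)) (o : Fin n) {d : ℕ}
  (V : Fin d → Finset (Fin n))

/-- **The observer's cluster inside `W` is the union of its block clusters.**  On the support event, with
`W ∖ o` covered by blocks `V l` that are pairwise non-adjacent (the observer's own pairs are arbitrary):
`o ↔ x` inside `W` iff `x = o` or `o ↔ x` inside some block `insert o (V l)`. [folklore] -/
theorem reach_observer_iff (hoW : o ∈ W) (hVW : ∀ l, V l ⊆ W)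
    (hcover : ∀ v ∈ W, v ≠ o → ∃ l, v ∈ V l)
    (hsep : ∀ l l', l ≠ l' → ∀ u ∈ V l, ∀ v ∈ V l', w s(u, v) = 0)
    (ω : BondConfig (Fin n)) (hG : ∀ e ∈ ω, w e ≠ 0) (x : Fin n) :
    (openGraph (ω ∩ ↑(W.sym2))).Reachable o x ↔
      x = o ∨ ∃ l, (openGraph (ω ∩ ↑((insert o (V l)).sym2))).Reachable o x := by
  constructor
  · intro h
    set Q : Set (Fin n) := {y | y = o ∨ ∃ l, (openGraph (ω ∩ ↑((insert o (V l)).sym2))).Reachable o y}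
      with hQ
    have hcl : ∀ u ∈ Q, ∀ v, (openGraph (ω ∩ ↑(W.sym2))).Adj u v → v ∈ Q := by
      intro u hu v huv
      rw [adj_restrict_iff] at huv
      obtain ⟨huvω, huW, hvW, hne⟩ := huv
      by_cases hvo : v = o
      · exact Or.inl hvo
      obtain ⟨l', hvl'⟩ := hcover v hvW hvo
      rcases hu with rfl | ⟨l, hreach⟩
      · refine Or.inr ⟨l', SimpleGraph.Adj.reachable ?_⟩
        rw [adj_restrict_iff]
        exact ⟨huvω, Finset.mem_insert_self _ _, Finset.mem_insert_of_mem hvl', hne⟩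
      · by_cases huo : u = o
        · subst huo
          refine Or.inr ⟨l', SimpleGraph.Adj.reachable ?_⟩
          rw [adj_restrict_iff]
          exact ⟨huvω, Finset.mem_insert_self _ _, Finset.mem_insert_of_mem hvl', hne⟩
        · have huB : u ∈ insert o (V l) := mem_of_reachable_restrict (Finset.mem_insert_self _ _) hreach
          have huVl : u ∈ V l := by
            rcases Finset.mem_insert.1 huB with h | h
            · exact absurd h huo
            · exact h
          have hll' : l' = l := by
            by_contra hll'
            exact hG _ huvω (by rw [Sym2.eq_swap]; exact hsep l' l hll' v hvl' u huVl)
          subst hll'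
          refine Or.inr ⟨l', hreach.trans (SimpleGraph.Adj.reachable ?_)⟩
          rw [adj_restrict_iff]
          exact ⟨huvω, huB, Finset.mem_insert_of_mem hvl', hne⟩
    exact mem_of_reachable_of_closed _ Q hcl (Or.inl rfl) h
  · rintro (rfl | ⟨l, hreach⟩)
    · exact SimpleGraph.Reachable.refl _
    · exact reachable_restrict_mono (Finset.insert_subset hoW (hVW l)) hreach

/-- **A block vertex not joined to the observer inside its block keeps its block cluster.**  On the support
event, for `c ∈ V i` with `¬ (c ↔ o inside insert o (V i))`: `c ↔ x` inside `W` iff `c ↔ x` inside the block.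
[folklore] -/
theorem reach_block_iff (hoV : ∀ l, o ∉ V l) (hoW : o ∈ W) (hVW : ∀ l, V l ⊆ W)
    (hcover : ∀ v ∈ W, v ≠ o → ∃ l, v ∈ V l)
    (hsep : ∀ l l', l ≠ l' → ∀ u ∈ V l, ∀ v ∈ V l', w s(u, v) = 0)
    (ω : BondConfig (Fin n)) (hG : ∀ e ∈ ω, w e ≠ 0) (i : Fin d) {c : Fin n} (hc : c ∈ V i)
    (hnot : ¬ (openGraph (ω ∩ ↑((insert o (V i)).sym2))).Reachable c o) (x : Fin n) :
    (openGraph (ω ∩ ↑(W.sym2))).Reachable c x ↔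
      (openGraph (ω ∩ ↑((insert o (V i)).sym2))).Reachable c x := by
  constructor
  · intro h
    set Q : Set (Fin n) := {y | (openGraph (ω ∩ ↑((insert o (V i)).sym2))).Reachable c y} with hQ
    have hcl : ∀ u ∈ Q, ∀ v, (openGraph (ω ∩ ↑(W.sym2))).Adj u v → v ∈ Q := by
      intro u hu v huv
      rw [adj_restrict_iff] at huv
      obtain ⟨huvω, huW, hvW, hne⟩ := huv
      have huB : u ∈ insert o (V i) := mem_of_reachable_restrict (Finset.mem_insert_of_mem hc) hu
      have huo : u ≠ o := by
        rintro rfl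
        exact hnot hu
      have huVi : u ∈ V i := by
        rcases Finset.mem_insert.1 huB with h | h
        · exact absurd h huo
        · exact h
      have hvB : v ∈ insert o (V i) := by
        by_cases hvo : v = o
        · rw [hvo]; exact Finset.mem_insert_self _ _
        obtain ⟨l', hvl'⟩ := hcover v hvW hvo
        have hll' : l' = i := by
          by_contra hll'
          exact hG _ huvω (by rw [Sym2.eq_swap]; exact hsep l' i hll' v hvl' u huVi)
        subst hll'
        exact Finset.mem_insert_of_mem hvl'
      show (openGraph (ω ∩ ↑((insert o (V i)).sym2))).Reachable c v
      refine SimpleGraph.Reachable.trans hu (SimpleGraph.Adj.reachable ?_)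
      rw [adj_restrict_iff]
      exact ⟨huvω, huB, hvB, hne⟩
    exact mem_of_reachable_of_closed _ Q hcl (SimpleGraph.Reachable.refl c) h
  · exact fun h => reachable_restrict_mono (Finset.insert_subset hoW (hVW i)) h

end Geometry


end Blocks

end SteinerPorts

end CutObserver

end Summit.CriticalPhenomena.PercolationContinuityZ3.Theorems

end
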